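import Summits.BirchSwinnertonDyer.BirchSwinnertonDyer.Theorems.ByReductionTypeAtTwoOrdKatoHalfAtTwoIsoSahRelNormal
import Summits.BirchSwinnertonDyer.BirchSwinnertonDyer.Theorems.SmallImageMuTransferMuTransferX9CentralScalar
import Literature.NumberTheory.EllipticCurves.TwoTorsionGaloisActionProofs
import Literature.NumberTheory.EllipticCurves.GaloisActionProofs
import HarnessLib

/-!
# Route ByReductionTypeAtTwo, crux `OrdKatoHalfAtTwoIso` (stmt-BirchSwinnertonDyer-19573), line
# `steinberg-fibre-at-two`: the STEINBERG–SAH lemma on the genuine `𝒯_J(E)` at `p = 2` — a continuous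
# 1-cocycle of `E[2] ⊗ 𝔽₂[T]/(T^J)(χ_κ)` vanishing on `ker ρ̄_{E,2} ⊓ Gal(ℚ̄/ℚ_∞)` has zero class, from a
# 3-CYCLE inside `Gal(ℚ̄/ℚ_∞)` (the `p = 2` replacement of the central scalar of `…X9CentralScalarOdd`)

Seat `cruxlead-stmt-BirchSwinnertonDyer-19573-g0` (LEAD PROVER, MODE LINE; HOME `run/shared/lean/pub/bsd-2adic/`; PORT-MAP
site (P1)). HONEST FRAMING (cell bsd-2adic): BSD is not proved by any of this; the crux `OrdKatoHalfAtTwoIso` is not proved here;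
theorems only (no definition, no named fact, no `sorry`); `--supports stmt-BirchSwinnertonDyer-19573 --as helper`.

WHAT. The four consumer lemmas of `Theorems/SmallImageMuTransferMuTransferX9CentralScalarOdd.lean` (`:148/:159/:170/:181`)
kill classes of the twisted modules `𝒯_J(E) = W.modPTwist p κ J` vanishing on `ker ρ̄_{E,p} ⊓ ker κ` using an element
`σ₀ ∈ ker κ` that acts on `E[p]` as a SCALAR `a ≠ 1` (central in the image; exists for `p ≠ 2`, `E[p]` irreducible,
`ρ̄` not onto). At `p = 2` the image `GL₂(𝔽₂) ≅ S₃` has trivial centre. This file proves the SAME FOUR STATEMENTS at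
`p = 2` (any `ℤ₂`-extension `κ` of `ℚ`, any `E/ℚ`) from a different datum: an element `σ₀ ∈ ker κ` acting on `E[2]`
WITHOUT NON-ZERO FIXED POINT (a 3-cycle on `{T₀, T₁, T₂}`) — which exists on the DD12 residue (`ρ̄₂` onto, `Δ < 0`: the
line's helpers W-Δ/W-D, `exists_mem_kerSubgroup_forall_smul_ne`). Proof = the engine
`SahRelNormal.oneCocycleClass_eq_of_forall_mem_eq_of_normal` (p656928) with `N = ker ρ̄₂ ⊓ ker κ`, `H = ker(sgn ∘ permGal)`
(the preimage of `A₃`; normal), `z = σ₀`: (i) `σ₀ ∈ H` and `σ₀` is central in `H` modulo `N` because `A₃` is abelian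
(a decidable fact about `Perm (Fin 3)`) and an element acting trivially on `{T_i}` lies in `ker ρ̄₂`; (ii) `ρ_𝒯(σ₀)`
commutes with `ρ_𝒯(h)`, `h ∈ H`: `ker κ` acts on `𝒯_J` coordinatewise (`modPTwist_apply_of_mem_kerSubgroup`), the twist
operator commutes with coordinatewise operators (`unipotentPow_mul_compLeft`), and `σ₀`, `h` commute on `E[2]`;
(iii) `x ↦ ρ_𝒯(σ₀)x − x` is injective coordinatewise (no fixed point), hence bijective (`𝒯_J` finite).

* `perm_fin_three_sign_eq_one_of_forall_ne`, `perm_fin_three_comm_of_sign_eq_one` — `S₃` facts by `decide`.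
* `permGal_eq_one_iff_forall_smul_eq`, `forall_smul_eq_iff_mem_ker` — dictionary `permGal σ = 1 ⟺ σ ∈ ker ρ̄₂`.
* `modPTwist_two_oneCocycleClass_eq_of_forall_mem_eq_of_noFixedPoint` — the injectivity form (shape `:148`, any `κ`,
  hence also the dual twist `κ.invTwist` = shape `:181`), `…eq_zero…` (shape `:159`), `…layerSubgroup…` (shape `:170`).

References: C.-H. Sah, J. Algebra 10 (1968) Prop. 2.7 (b); J.-P. Serre, Invent. Math. 15 (1972) §2.6; HOME
`koly/MU-TRANSFER-PROOF.md` (F8); the tree's `…X9CentralScalar.lean`, `…X9CentralScalarOdd.lean`, `IwasawaTwistModP.lean`,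
`TwoTorsionGaloisActionProofs.lean`; the lead's `PORT-MAP-stub_port.md` (P1).
-/

set_option autoImplicit false
set_option linter.dupNamespace false

noncomputable section

open Field WeierstrassCurve Function
open Literature.NumberTheory.EllipticCurves Literature.NumberTheory.GaloisRepresentations
open Literature.NumberTheory.EllipticCurves.DokchitserDokchitser2012
open Summit.BirchSwinnertonDyer.BirchSwinnertonDyer.Rank1Residual

namespace Summit.BirchSwinnertonDyer.BirchSwinnertonDyer.Theorems.SteinbergFibreAtTwo

/-! ## §1 Two decidable facts about `S₃ = Perm (Fin 3)` -/

/-- A permutation of three letters without fixed point is EVEN (it is a 3-cycle). [folklore] -/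
theorem perm_fin_three_sign_eq_one_of_forall_ne :
    ∀ g : Equiv.Perm (Fin 3), (∀ i, g i ≠ i) → Equiv.Perm.sign g = 1 := by
  decide

/-- `A₃` is abelian: two even permutations of three letters commute. [folklore] -/
theorem perm_fin_three_comm_of_sign_eq_one :
    ∀ a b : Equiv.Perm (Fin 3), Equiv.Perm.sign a = 1 → Equiv.Perm.sign b = 1 → a * b = b * a := by
  decide

/-! ## §2 The dictionary `permGal σ = 1 ⟺ σ` acts trivially on `E[2]` `⟺ σ ∈ ker ρ̄₂` -/

section Dictionary

variable (W : WeierstrassCurve ℚ) [W.IsElliptic]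

/-- `σ` fixes every `2`-torsion point iff it fixes the three letters `T_i` (`E[2] = {O, T₀, T₁, T₂}`).
[cite: SilvermanAEC2009, III.§7 (the representation G_{K̄/K} → Aut(E[m]))] -/
theorem forall_smul_eq_iff_permGal_eq_one (σ : absoluteGaloisGroup ℚ) :
    (∀ P : geomTorsion W 2, σ • P = P) ↔ permGal W (two_ne_zero : (2 : ℚ) ≠ 0) σ = 1 := by
  constructor
  · intro h
    refine Equiv.ext fun i => T_injective W two_ne_zero ?_
    rw [T_permGal, h, Equiv.Perm.coe_one, id]
  · intro h P
    rcases eq_zero_or_eq_T W two_ne_zero P with rfl | ⟨i, rfl⟩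
    · exact smul_zero σ
    · rw [← T_permGal, h, Equiv.Perm.coe_one, id]

omit [W.IsElliptic] in
/-- `σ ∈ ker ρ̄_{E,2}` iff `σ` fixes every `2`-torsion point. [cite: SilvermanAEC2009, III.§7] -/
theorem mem_ker_galoisRepTorsion_two_iff (σ : absoluteGaloisGroup ℚ) :
    σ ∈ (galoisRepTorsion W 2).ker ↔ ∀ P : geomTorsion W 2, σ • P = P := by
  rw [MonoidHom.mem_ker]
  constructor
  · intro h P
    rw [← galoisRepTorsion_apply, h]
    rfl
  · intro h
    refine Multiplicative.toAdd.injective (AddEquiv.ext fun P => ?_)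
    rw [galoisRepTorsion_apply]
    exact h P

/-- Two Galois elements inducing the same permutation of `{T₀, T₁, T₂}` act identically on `E[2]`.
[cite: SilvermanAEC2009, III.§7] -/
theorem smul_eq_smul_of_permGal_eq {σ τ : absoluteGaloisGroup ℚ}
    (h : permGal W (two_ne_zero : (2 : ℚ) ≠ 0) σ = permGal W two_ne_zero τ) (P : geomTorsion W 2) :
    σ • P = τ • P := by
  rcases eq_zero_or_eq_T W two_ne_zero P with rfl | ⟨i, rfl⟩
  · rw [smul_zero, smul_zero]
  · rw [← T_permGal, ← T_permGal, h]

end Dictionary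

/-! ## §3 The Steinberg–Sah lemma on `𝒯_J(E)` at `p = 2` -/

section SteinbergSah

variable (W : WeierstrassCurve ℚ) [W.IsElliptic] (κ : ZpExtension ℚ 2)

/-- **Steinberg–Sah on the genuine `𝒯_J(E)` at `p = 2`, injectivity form (shape of `…X9CentralScalarOdd:148`, any
`ℤ₂`-extension `κ` — in particular also the dual twist).** Let `σ₀ ∈ ker κ` act on `E[2]` without non-zero fixed point.
Then two continuous 1-cocycles of `Γ_ℚ` in `𝒯_J(E) = W.modPTwist 2 κ J` that agree on `ker ρ̄_{E,2} ⊓ ker κ` have the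
same class. (Engine `SahRelNormal` with `H = ker(sgn ∘ permGal) ⊇ N = ker ρ̄₂ ⊓ ker κ`, `z = σ₀`.)
[cite: Sah1968, Prop. 2.7 (b) and its proof, p. 60] [cite: Serre1972, §2.6] -/
theorem modPTwist_two_oneCocycleClass_eq_of_forall_mem_eq_of_noFixedPoint {σ₀ : absoluteGaloisGroup ℚ}
    (hκ : σ₀ ∈ κ.kerSubgroup) (hσ₀ : ∀ P : geomTorsion W 2, P ≠ 0 → σ₀ • P ≠ P) (J : ℕ)
    (φ ψ : contOneCocycles (W.modPTwist 2 κ J).toTopRep)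
    (hN : ∀ ν ∈ (galoisRepTorsion W 2).ker ⊓ κ.kerSubgroup, φ.1 ν = ψ.1 ν) :
    oneCocycleClass _ φ = oneCocycleClass _ ψ := by
  have h2 : (2 : ℚ) ≠ 0 := two_ne_zero
  -- the permutation representation on `{T₀, T₁, T₂}` as a homomorphism, and `H = ker (sgn ∘ permGal)`
  let πG : absoluteGaloisGroup ℚ →* Equiv.Perm (Fin 3) :=
    { toFun := permGal W h2, map_one' := permGal_one W h2, map_mul' := permGal_mul W h2 }
  let H : Subgroup (absoluteGaloisGroup ℚ) := (Equiv.Perm.sign.comp πG).ker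
  have hHmem : ∀ g, g ∈ H ↔ Equiv.Perm.sign (permGal W h2 g) = 1 := fun g => by
    change (Equiv.Perm.sign.comp πG) g = 1 ↔ _
    rfl
  have hHnormal : H.Normal := MonoidHom.normal_ker _
  -- `σ₀` is a 3-cycle: even
  have hσ₀T : ∀ i, permGal W h2 σ₀ i ≠ i := by
    intro i hi
    have hT : σ₀ • T W h2 i = T W h2 i := by rw [← T_permGal, hi]
    exact hσ₀ (T W h2 i) (fun h0 => coe_T_ne_zero W h2 i (by rw [h0]; rfl)) hT
  have hσ₀H : σ₀ ∈ H := (hHmem σ₀).mpr (perm_fin_three_sign_eq_one_of_forall_ne _ hσ₀T)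
  -- `N ≤ H`
  have hNH : (galoisRepTorsion W 2).ker ⊓ κ.kerSubgroup ≤ H := by
    intro ν hν
    have hν1 : permGal W h2 ν = 1 :=
      (forall_smul_eq_iff_permGal_eq_one W ν).mp
        ((mem_ker_galoisRepTorsion_two_iff W ν).mp (Subgroup.mem_inf.mp hν).1)
    rw [hHmem, hν1, map_one]
  -- `σ₀` and `h ∈ H` commute on `E[2]`
  have hcommE : ∀ h ∈ H, ∀ P : geomTorsion W 2, σ₀ • h • P = h • σ₀ • P := by
    intro h hh P
    have hperm : permGal W h2 (σ₀ * h) = permGal W h2 (h * σ₀) := by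
      rw [permGal_mul, permGal_mul]
      exact perm_fin_three_comm_of_sign_eq_one _ _ ((hHmem σ₀).mp hσ₀H) ((hHmem h).mp hh)
    rw [← mul_smul, ← mul_smul]
    exact smul_eq_smul_of_permGal_eq W hperm P
  -- centrality of `σ₀` inside `H` modulo `N`
  have hz : ∀ h ∈ H, ∃ n ∈ (galoisRepTorsion W 2).ker ⊓ κ.kerSubgroup, σ₀ * h = h * σ₀ * n := by
    intro h hh
    refine ⟨(h * σ₀)⁻¹ * (σ₀ * h), Subgroup.mem_inf.mpr ⟨?_, ?_⟩, by group⟩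
    · rw [mem_ker_galoisRepTorsion_two_iff]
      intro P
      rw [mul_smul, mul_smul, hcommE h hh P, ← mul_smul h σ₀, inv_smul_smul]
    · rw [ZpExtension.mem_kerSubgroup] at hκ ⊢
      rw [map_mul, map_inv, map_mul, map_mul, hκ, mul_one, one_mul, inv_mul_cancel]
  -- `ρ_𝒯(σ₀)` is coordinatewise `σ₀`
  have hρσ₀ : ∀ x : (W.modPTwist 2 κ J).toTopRep,
      (W.modPTwist 2 κ J).toTopRep.ρ σ₀ x = fun i => σ₀ • x i :=
    fun x => modPTwist_apply_of_mem_kerSubgroup W 2 κ J hκ x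
  -- `ρ_𝒯(σ₀)` commutes with `ρ_𝒯(h)`, `h ∈ H`
  let f : geomTorsion W ((2 : ℕ) : ℤ) →ₗ[ℤ] geomTorsion W ((2 : ℕ) : ℤ) :=
    (DistribSMul.toAddMonoidHom (geomTorsion W ((2 : ℕ) : ℤ)) σ₀).toIntLinearMap
  have hf : ∀ y : Fin J → geomTorsion W ((2 : ℕ) : ℤ), f.compLeft (Fin J) y = fun i => σ₀ • y i :=
    fun _ => rfl
  have hcomm : ∀ h ∈ H, ∀ x : (W.modPTwist 2 κ J).toTopRep,
      (W.modPTwist 2 κ J).toTopRep.ρ σ₀ ((W.modPTwist 2 κ J).toTopRep.ρ h x) =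
        (W.modPTwist 2 κ J).toTopRep.ρ h ((W.modPTwist 2 κ J).toTopRep.ρ σ₀ x) := by
    intro h hh x
    rw [hρσ₀, hρσ₀]
    change (fun i => σ₀ • (W.modPTwist 2 κ J h x) i) = W.modPTwist 2 κ J h (fun i => σ₀ • x i)
    rw [WeierstrassCurve.modPTwist_apply, WeierstrassCurve.modPTwist_apply, ← hf,
      ← Module.End.mul_apply, ← ZpExtension.unipotentPow_mul_compLeft, Module.End.mul_apply, hf]
    congr 1
    funext i
    exact hcommE h hh (x i)
  -- `ρ_𝒯(σ₀) − 1` is bijective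
  haveI : Finite (geomTorsion W (2 : ℤ)) :=
    WeierstrassCurve.finite_torsionPoints_holds W (AlgebraicClosure ℚ) (by norm_num)
  have hbij : Bijective fun x : (W.modPTwist 2 κ J).toTopRep => (W.modPTwist 2 κ J).toTopRep.ρ σ₀ x - x := by
    have hinj : Injective fun x : (W.modPTwist 2 κ J).toTopRep =>
        (W.modPTwist 2 κ J).toTopRep.ρ σ₀ x - x := by
      intro x y hxy
      have hxy' : ∀ i, σ₀ • (x i - y i) = x i - y i := by
        intro i
        have := congrFun (show (fun i => σ₀ • x i) - x = (fun i => σ₀ • y i) - y by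
          simpa only [hρσ₀] using hxy) i
        simp only [Pi.sub_apply] at this
        rw [smul_sub]
        -- σ₀ x i - x i = σ₀ y i - y i  ⇒  σ₀ x i - σ₀ y i = x i - y i
        have := sub_eq_sub_iff_sub_eq_sub.mp this
        exact this
      funext i
      by_contra hne
      exact hσ₀ (x i - y i) (sub_ne_zero.mpr hne) (hxy' i)
    exact ⟨hinj, Finite.injective_iff_surjective.mp hinj⟩
  exact SahRelNormal.oneCocycleClass_eq_of_forall_mem_eq_of_normal φ ψ _ H hHnormal hNH hN hσ₀H hz hcomm hbij

/-- **Vanishing form** (shape of `…X9CentralScalarOdd:159`): a continuous 1-cocycle of `𝒯_J(E)` at `p = 2` vanishing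
on `ker ρ̄_{E,2} ⊓ ker κ` has zero class, given a fixed-point-free `σ₀ ∈ ker κ`.
[cite: Sah1968, Prop. 2.7 (b) and its proof, p. 60] [cite: Serre1972, §2.6] -/
theorem modPTwist_two_oneCocycleClass_eq_zero_of_forall_mem_eq_zero_of_noFixedPoint
    {σ₀ : absoluteGaloisGroup ℚ} (hκ : σ₀ ∈ κ.kerSubgroup)
    (hσ₀ : ∀ P : geomTorsion W 2, P ≠ 0 → σ₀ • P ≠ P) (J : ℕ)
    (φ : contOneCocycles (W.modPTwist 2 κ J).toTopRep)
    (hN : ∀ ν ∈ (galoisRepTorsion W 2).ker ⊓ κ.kerSubgroup, φ.1 ν = 0) :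
    oneCocycleClass _ φ = 0 := by
  rw [← oneCocycleClass_zero (W.modPTwist 2 κ J).toTopRep]
  exact modPTwist_two_oneCocycleClass_eq_of_forall_mem_eq_of_noFixedPoint W κ hκ hσ₀ J φ 0
    (fun ν hν => by rw [hN ν hν]; rfl)

/-- **Layer form** (shape of `…X9CentralScalarOdd:170`): agreement on `ker ρ̄_{E,2} ⊓ Gal(ℚ̄/ℚ_n)` suffices
(`ker κ ≤ κ.layerSubgroup n`). [cite: Sah1968, Prop. 2.7 (b) and its proof, p. 60] [cite: Washington1997, §13.1] -/
theorem modPTwist_two_oneCocycleClass_eq_of_forall_mem_layerSubgroup_eq_of_noFixedPoint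
    {σ₀ : absoluteGaloisGroup ℚ} (hκ : σ₀ ∈ κ.kerSubgroup)
    (hσ₀ : ∀ P : geomTorsion W 2, P ≠ 0 → σ₀ • P ≠ P) (J n : ℕ)
    (φ ψ : contOneCocycles (W.modPTwist 2 κ J).toTopRep)
    (hN : ∀ ν ∈ (galoisRepTorsion W 2).ker ⊓ κ.layerSubgroup n, φ.1 ν = ψ.1 ν) :
    oneCocycleClass _ φ = oneCocycleClass _ ψ :=
  modPTwist_two_oneCocycleClass_eq_of_forall_mem_eq_of_noFixedPoint W κ hκ hσ₀ J φ ψ fun ν hν =>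
    hN ν (Subgroup.mem_inf.mpr
      ⟨(Subgroup.mem_inf.mp hν).1, κ.kerSubgroup_le_layerSubgroup n (Subgroup.mem_inf.mp hν).2⟩)

/-- **Dual-twist form** (shape of `…X9CentralScalarOdd:181`): the same for `W.modPTwist 2 κ.invTwist J` with the SAME
subgroup `ker ρ̄_{E,2} ⊓ ker κ` and the same `σ₀` (`ker κ⁻¹ = ker κ`).
[cite: Sah1968, Prop. 2.7 (b) and its proof, p. 60] [cite: Washington1997, §13.1] -/
theorem invTwist_modPTwist_two_oneCocycleClass_eq_of_forall_mem_eq_of_noFixedPoint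
    {σ₀ : absoluteGaloisGroup ℚ} (hκ : σ₀ ∈ κ.kerSubgroup)
    (hσ₀ : ∀ P : geomTorsion W 2, P ≠ 0 → σ₀ • P ≠ P) (J : ℕ)
    (φ ψ : contOneCocycles (W.modPTwist 2 κ.invTwist J).toTopRep)
    (hN : ∀ ν ∈ (galoisRepTorsion W 2).ker ⊓ κ.kerSubgroup, φ.1 ν = ψ.1 ν) :
    oneCocycleClass _ φ = oneCocycleClass _ ψ := by
  have hκ' : σ₀ ∈ κ.invTwist.kerSubgroup := by
    rw [ZpExtension.kerSubgroup_unitTwist]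
    exact hκ
  refine modPTwist_two_oneCocycleClass_eq_of_forall_mem_eq_of_noFixedPoint W κ.invTwist hκ' hσ₀ J φ ψ ?_
  rw [ZpExtension.kerSubgroup_unitTwist]
  exact hN

end SteinbergSah

end Summit.BirchSwinnertonDyer.BirchSwinnertonDyer.Theorems.SteinbergFibreAtTwo

end
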